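import Summits.QuantumFields.YangMills.Theorems.UnitScaleTiltProp7LegLemmaQTw
import Summits.QuantumFields.YangMills.Theorems.UnitScaleTiltProp7TrueLinRealityFamilies
import Summits.QuantumFields.YangMills.Theorems.UnitScaleTiltProp7FrameResponseCombSU2T3
import Summits.QuantumFields.YangMills.Theorems.UnitScaleTiltProp7CurvedLandauRowA
import Summits.QuantumFields.YangMills.Theorems.UnitScaleTiltProp7QTwCentralValued
import Summits.QuantumFields.YangMills.Theorems.UnitScaleTiltProp7RieszTauFrobNormT3
import Summits.QuantumFields.YangMills.Theorems.UnitScaleTiltProp7LandauTransversalityMarginSU2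
import Summits.QuantumFields.YangMills.Theorems.UnitScaleTiltProp7TrueAvgBudgetCentral
import Literature.MathematicalPhysics.QuantumFieldTheory.Balaban1983to89.B9Eq310Hermitian
import Literature.MathematicalPhysics.QuantumFieldTheory.Balaban1983to89.B10Eq27TorusAxialLog
import HarnessLib

/-!
# Route `UnitScaleTilt`, crux K1 child «MinimiserStabilityRegPr» (stmt-QuantumFields-19200), stub `stub_existenceMinimalOrbit` (EX), lane II (QH1)♮ ∕ (QB) —
# **THE COMB CHART `Q(W) = QTw W` RESPECTS THE THREE SECTORS `M₂(ℂ) = 𝔰𝔲(2) ⊕ i·𝔰𝔲(2) ⊕ ℂ·1`, AND THE QUADRATIC CURRENCIES OF (QH1)∕(QB) SPLIT ALONG THEM EXACTLY**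
# (px22 g6 LOCATE v4 §4 (ii) «the sector-split rows for `QTw`∕`curl`∕`divB`»; first refusal px10, bus 11:53Z)

Cell `ym3-torus`, width seat `ym3-torus-px10` (gen 5).  `--supports stmt-QuantumFields-19200 --as helper`; THEOREMS ONLY (0 `def`, 0 `sorry`); count-neutral; nothing here claims the
stub, the crux, d = 4 or the mass gap — YM₃ on T³ is a ladder rung (R3), not the Clay problem.

THE MATHEMATICS.  ✓p711805's `hQH1` binder quantifies over ALL `M₂(ℂ)`-valued one-forms, while the LEG LEMMA (✓`Prop7LegLemmaQTw.QTw_apply_eq_trueLinIter_sub_coarseGauge_T3`), the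
(QE′-H¹) row and the corner-frame legs `rlegs` are `𝔰𝔲(2)`-rows and (QB-c) (this seat) is the `ℂ·1`-row.  The bridge is sector algebra: (a) ★★`QTw_su_of_regPr` — at a printed-regular
`W` (`10¹⁰L⁶ε₀ ≤ 1`) the comb chart maps `𝔰𝔲(2)`-valued fields to `𝔰𝔲(2)`-valued block fields (LEG: `QTw W A c = Q^{(K−n)}A ĉ − (r(c₋)A − W̄ r(c₊)A W̄ᴴ)` with `Q^{(K−n)}A ĉ ∈ 𝔰𝔲(2)` by
✓`Prop7TrueLinRealityFamilies.su_trueLinIter` under ✓`tower_loop_rows_of_regPr`'s guards and `r(y)A ∈ 𝔰𝔲(2)` by ✓`Prop7FrameResponseCombSU2.combFrameResponse_mem_skewAdjoint_trace_zero`;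
the comb twin of ✓`Prop7QTwSReality.QTwS_skewHermitian_traceless_of_regPr`); (b) the three sectors are HILBERT–SCHMIDT ORTHOGONAL (`tr(XY) ∈ ℝ` for skew-Hermitian `X, Y`; `tr X = 0`
kills the pairing with `ℂ·1`), so `‖X + iY + s·1‖_F² = ‖X‖_F² + ‖Y‖_F² + ‖s·1‖_F²`; (c) every ℂ-linear, sector-preserving map — `QTw W` by (a) and ✓p709300 (centre ↦ centre), the
covariant curl∕divergence of [Balaban1985BackgroundPropagators] (3.4)∕(3.8) at ANY unitary background (`R(U)` preserves `𝔰𝔲(2)`, central fields have flat stencils) — therefore has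
its Frobenius square SPLIT as the sum of the three sector squares, with the SAME constants: the all-`f` rows of (QH1)∕(QB) follow from the sector rows term by term.

WHAT IS PROVED (sorry-free, no definition):
* §1 matrix algebra on `M₂(ℂ)`: `star_trace_mul_of_skew`, `re_inner_frob_skew_I_smul`, `re_inner_frob_traceless_smul_one`, `normSq_frob_I_smul`, ★`normSq_frob_sectors`
  (`‖frobEquiv⁻¹(X + I•Y + s•1)‖² = ‖frobEquiv⁻¹X‖² + ‖frobEquiv⁻¹Y‖² + ‖frobEquiv⁻¹(s•1)‖²`), `sum_normSq_entries_sectors` (the same in the entrywise currency `Σ_{jk}‖M j k‖²`),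
  `exists_sector_fields` (every `M₂(ℂ)`-valued field is `A₁ + I•A₂ + τ•1` with `A₁, A₂` `𝔰𝔲(2)`-valued; ✓`Prop7LandauTransversalityMargin.decomp_su2` fieldwise).
* §2 `ten7_of_ten10` (window bookkeeping), ★★`QTw_su_of_regPr` (statement (a)).
* §3 ★★★`normSq_QTw_sectors_of_regPr` — at `W ∈ RegPr F n K ε₀`, `10¹⁰L⁶ε₀ ≤ 1`, for `𝔰𝔲(2)`-valued `A₁ A₂`, scalar `τ`, every block bond `c`:
  `‖frobEquiv⁻¹(QTw W (A₁ + I•A₂ + τ•1) c)‖² = ‖frobEquiv⁻¹(QTw W A₁ c)‖² + ‖frobEquiv⁻¹(QTw W A₂ c)‖² + ‖frobEquiv⁻¹(QTw W (τ•1) c)‖²`, and its sum over `c` (`sum_normSq_QTw_sectors_of_regPr`).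
* §4 (any shifts `T`, any UNITARY-valued background `U`, lit `B9Eq39Adjoint` letters): `su_R`, `star_inv_mul_inv_of_unitary`, `su_covD`, `su_covDstar`, ★`su_curl`, ★`su_divB` (covariant stencils preserve `𝔰𝔲(2)`;
  central fields: ✓`Prop7TrueAvgBudgetCentral.curl_smul_one`∕`divB_smul_one`), `divB_add_apply`∕`divB_smul_apply` (linearity of `divB`, pointwise),
  ★★`normSq_curl_sectors`∕★★`normSq_divB_sectors` (Frobenius form) and ★★`sum_normSq_curl_entries_sectors`∕`sum_normSq_divB_entries_sectors` (the entrywise currency of ✓p706335's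
  `hQB` ∕ `CURL_HS`, `DIV_HS`).
* §5 member instances at `T := torusT (F.P K) 0`, `U := unitsField (toUField W)` (`star_unitsField_toUField_mul`: the background is unitary): ★★`sum_normSq_curl_entries_sectors_member`,
  ★★`sum_normSq_divB_entries_sectors_member` — `CURL_HS`∕`DIV_HS` of ✓p706335 split per plaquette ∕ per site.
HONEST SCOPE.  Algebra + by-name knit; no estimate; nothing of (QH1)∕(QB)∕(REC)∕`hN06`∕the crux is advanced by this file alone; nothing of print is asserted.

References: T. Bałaban, CMP **99** (1985) 389–434 [Balaban1985BackgroundPropagators] ((3.3)–(3.5) pp.390–391, (3.8) p.392, (3.13)–(3.15) p.393, «complexified Lie algebra»); CMP **102**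
(1985) 277–309 [Balaban1985Variational] ((44) p.285, (51) p.286 «for A′ with values in 𝔤 the configuration … has values in 𝔤 also»); CMP **95** (1984) 17–40 [Balaban1984PropagatorsI]
((1.18)–(1.20) pp.19–20).
-/

set_option autoImplicit false

noncomputable section

open scoped BigOperators Matrix.Norms.L2Operator InnerProductSpace ComplexConjugate

namespace Summit.QuantumFields.YangMills.Theorems.Prop7QTwSectors

open Literature.MathematicalPhysics.QuantumFieldTheory.Balaban1983to89
open Literature.MathematicalPhysics.QuantumFieldTheory.Balaban1983to89.T3ContinuumYM3Torus
open T4Continuum BlockAveraging AveragingRT ExpMeanLog BlockAveragingEMLLinearised BlockAveragingEMLLinearisedBackground BlockAveragingEMLProp2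
open T3PrintedRegularMinimiser (RegPr)
open T3LevelShift (bondShift)
open T3PrintedRegularOrbits (sites_eq)
open B9Eq39Adjoint (R R_def R_smul R_apply_one R_add covD covDstar curl divB covD_add covDstar_add covD_smul covDstar_smul curl_smul)
open B9Eq310Hermitian (curl_add)
open B10Eq27TorusAxialLog (unitsField toUField)
open B9TorusCalculus (torusT)
open Summit.QuantumFields.YangMills.Theorems.Prop7SectET3HilbertLetters (W₂ frobEquiv inner_frobEquiv_symm)
open Summit.QuantumFields.YangMills.Theorems.Prop7RieszTauFrobNorm (norm_sq_frobEquiv_symm)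
open Summit.QuantumFields.YangMills.Theorems.Prop7SymAvgTw (QTw frameTw)
open Summit.QuantumFields.YangMills.Theorems.Prop7TrueLinReality (su_zero su_add su_sub su_neg su_smul_real su_sum su_conj su_conj_coe)
open Summit.QuantumFields.YangMills.Theorems.Prop7TrueLinRealityFamilies (su_trueLinIter)
open Summit.QuantumFields.YangMills.Theorems.Prop7FirstVariationExactPairing (tower_loop_rows_of_regPr)
open Summit.QuantumFields.YangMills.Theorems.Prop7LegLemmaQTw (QTw_apply_eq_trueLinIter_sub_coarseGauge_T3)
open Summit.QuantumFields.YangMills.Theorems.Prop7FrameResponseCombSU2 (combFrameResponse_mem_skewAdjoint_trace_zero)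
open Summit.QuantumFields.YangMills.Theorems.Prop7CurvedLandauRowA (exists_trueLinIter_family)
open Summit.QuantumFields.YangMills.Theorems.Prop7QTwCentralValued (exists_QTw_smul_one_eq_smul_one_of_regPr)
open Summit.QuantumFields.YangMills.Theorems.Prop7LandauTransversalityMargin (decomp_su2)
open Summit.QuantumFields.YangMills.Theorems.Prop7TrueAvgBudgetCentral (curl_smul_one divB_smul_one)

/-! ## §1 Matrix algebra: the three sectors of `M₂(ℂ)` are Hilbert–Schmidt orthogonal -/

section Algebra

/-- For skew-Hermitian `X, Y` the trace of `XY` is self-conjugate (`(XY)ᴴ = YX`). [folklore] -/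
theorem star_trace_mul_of_skew {X Y : Matrix (Fin 2) (Fin 2) ℂ} (hX : star X = -X) (hY : star Y = -Y) :
    star (X * Y).trace = (X * Y).trace := by
  rw [← Matrix.trace_conjTranspose, Matrix.conjTranspose_mul, ← Matrix.star_eq_conjTranspose, ← Matrix.star_eq_conjTranspose, hX, hY,
    neg_mul_neg, Matrix.trace_mul_comm]

/-- `𝔰𝔲(2) ⊥ i·𝔰𝔲(2)` in the Frobenius pairing: `re ⟪X, I•Y⟫ = 0` for skew-Hermitian `X, Y`. [folklore] -/
theorem re_inner_frob_skew_I_smul {X Y : Matrix (Fin 2) (Fin 2) ℂ} (hX : star X = -X) (hY : star Y = -Y) :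
    RCLike.re ⟪(frobEquiv.symm X : W₂), (frobEquiv.symm (Complex.I • Y) : W₂)⟫_ℂ = 0 := by
  rw [inner_frobEquiv_symm, Matrix.mul_smul, Matrix.trace_smul, smul_eq_mul]
  have hXY : (X.conjTranspose * Y).trace = -(X * Y).trace := by
    rw [← Matrix.star_eq_conjTranspose, hX, neg_mul, Matrix.trace_neg]
  have hreal : ((X * Y).trace).im = 0 := by
    have h := congrArg Complex.im (star_trace_mul_of_skew hX hY)
    rw [Complex.star_def, Complex.conj_im] at h
    linarith
  rw [hXY, RCLike.re_to_complex, Complex.mul_re, Complex.neg_re, Complex.neg_im, Complex.I_re, Complex.I_im, hreal]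
  ring

/-- The traceless matrices are Frobenius-orthogonal to `ℂ·1`: `re ⟪X, s•1⟫ = 0` when `tr X = 0`. [folklore] -/
theorem re_inner_frob_traceless_smul_one {X : Matrix (Fin 2) (Fin 2) ℂ} (hX : X.trace = 0) (s : ℂ) :
    RCLike.re ⟪(frobEquiv.symm X : W₂), (frobEquiv.symm (s • (1 : Matrix (Fin 2) (Fin 2) ℂ)) : W₂)⟫_ℂ = 0 := by
  rw [inner_frobEquiv_symm, Matrix.mul_smul, Matrix.mul_one, Matrix.trace_smul, Matrix.trace_conjTranspose, hX, star_zero, smul_zero, map_zero]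

/-- `‖frobEquiv⁻¹(I•Y)‖² = ‖frobEquiv⁻¹Y‖²`. [folklore] -/
theorem normSq_frob_I_smul (Y : Matrix (Fin 2) (Fin 2) ℂ) :
    ‖(frobEquiv.symm (Complex.I • Y) : W₂)‖ ^ 2 = ‖(frobEquiv.symm Y : W₂)‖ ^ 2 := by
  rw [map_smul, norm_smul, Complex.norm_I, one_mul]

/-- ★ **PYTHAGORAS ACROSS THE THREE SECTORS**: for `X, Y ∈ 𝔰𝔲(2)` and `s ∈ ℂ`, `‖X + I•Y + s•1‖_F² = ‖X‖_F² + ‖Y‖_F² + ‖s•1‖_F²` (Frobenius norm via the cell's `frobEquiv`).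
[cite: Balaban1985BackgroundPropagators, (3.11) p.392] -/
theorem normSq_frob_sectors {X Y : Matrix (Fin 2) (Fin 2) ℂ} (hX : star X = -X ∧ X.trace = 0) (hY : star Y = -Y ∧ Y.trace = 0) (s : ℂ) :
    ‖(frobEquiv.symm (X + Complex.I • Y + s • (1 : Matrix (Fin 2) (Fin 2) ℂ)) : W₂)‖ ^ 2
      = ‖(frobEquiv.symm X : W₂)‖ ^ 2 + ‖(frobEquiv.symm Y : W₂)‖ ^ 2 + ‖(frobEquiv.symm (s • (1 : Matrix (Fin 2) (Fin 2) ℂ)) : W₂)‖ ^ 2 := by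
  have hIY : (Complex.I • Y).trace = 0 := by rw [Matrix.trace_smul, hY.2, smul_zero]
  have hXIY : (X + Complex.I • Y).trace = 0 := by rw [Matrix.trace_add, hX.2, hIY, add_zero]
  rw [map_add, norm_add_sq (𝕜 := ℂ), re_inner_frob_traceless_smul_one hXIY, map_add, norm_add_sq (𝕜 := ℂ),
    re_inner_frob_skew_I_smul hX.1 hY.1, normSq_frob_I_smul]
  ring

/-- The same Pythagoras in the ENTRYWISE currency `Σ_{j,k} ‖M j k‖²` of ✓`Prop7EngOfTrueAvgBudget`'s `CURL_HS`∕`DIV_HS` (✓`norm_sq_frobEquiv_symm`). [cite: Balaban1985BackgroundPropagators, (3.11) p.392] -/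
theorem sum_normSq_entries_sectors {X Y : Matrix (Fin 2) (Fin 2) ℂ} (hX : star X = -X ∧ X.trace = 0) (hY : star Y = -Y ∧ Y.trace = 0) (s : ℂ) :
    ∑ j : Fin 2, ∑ k : Fin 2, ‖(X + Complex.I • Y + s • (1 : Matrix (Fin 2) (Fin 2) ℂ)) j k‖ ^ 2
      = (∑ j : Fin 2, ∑ k : Fin 2, ‖X j k‖ ^ 2) + (∑ j : Fin 2, ∑ k : Fin 2, ‖Y j k‖ ^ 2)
        + ∑ j : Fin 2, ∑ k : Fin 2, ‖(s • (1 : Matrix (Fin 2) (Fin 2) ℂ)) j k‖ ^ 2 := by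
  rw [← norm_sq_frobEquiv_symm, ← norm_sq_frobEquiv_symm, ← norm_sq_frobEquiv_symm, ← norm_sq_frobEquiv_symm]
  exact normSq_frob_sectors hX hY s

/-- **SECTOR DECOMPOSITION OF FIELDS**: every `M₂(ℂ)`-valued field is `A₁ + I•A₂ + τ•1` with `A₁, A₂` `𝔰𝔲(2)`-valued and `τ = tr∕2` (✓`decomp_su2` fieldwise). [folklore] -/
theorem exists_sector_fields {ι : Type*} (A : ι → Matrix (Fin 2) (Fin 2) ℂ) :
    ∃ (A₁ A₂ : ι → Matrix (Fin 2) (Fin 2) ℂ) (τ : ι → ℂ),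
      (∀ b, star (A₁ b) = -A₁ b ∧ (A₁ b).trace = 0) ∧ (∀ b, star (A₂ b) = -A₂ b ∧ (A₂ b).trace = 0) ∧
        A = fun b => A₁ b + Complex.I • A₂ b + τ b • (1 : Matrix (Fin 2) (Fin 2) ℂ) := by
  choose a b ha hb hab using fun i => decomp_su2 (A i)
  exact ⟨a, b, fun i => (2 : ℂ)⁻¹ * (A i).trace, ha, hb, funext fun i => hab i⟩

end Algebra

/-! ## §2 The comb chart maps `𝔰𝔲(2)`-valued fields to `𝔰𝔲(2)`-valued block fields -/

section Comb

variable (F : T3Family) {n K : ℕ} (h : n ≤ K)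

/-- the weaker window from the stronger one (`L ≥ 3`). [cite: Balaban1985Variational, (2) p.278] -/
theorem ten7_of_ten10 {ε₀ : ℝ} (hε₀ : 0 < ε₀) (hε : 10 ^ 10 * (F.L : ℝ) ^ 6 * ε₀ ≤ 1) : 10 ^ 7 * (F.L : ℝ) ^ 3 * ε₀ ≤ 1 := by
  have hL3 : (3 : ℝ) ≤ (F.L : ℝ) := by
    have h3 : 3 ≤ F.L := by obtain ⟨a, ha⟩ := F.hL.1; have := F.hL.2; omega
    exact_mod_cast h3
  have hL1 : (1 : ℝ) ≤ (F.L : ℝ) := by linarith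
  have h36 : (F.L : ℝ) ^ 3 ≤ (F.L : ℝ) ^ 6 := pow_le_pow_right₀ hL1 (by norm_num)
  nlinarith [h36, hε₀.le, pow_nonneg (zero_le_one.trans hL1) 3]

/-- ★★ **THE COMB CHART `Q(W) = QTw W` MAPS `𝔰𝔲(2)`-VALUED FIELDS TO `𝔰𝔲(2)`-VALUED BLOCK FIELDS** at `W ∈ 𝔘_k(ε₀)`, `10¹⁰L⁶ε₀ ≤ 1`: LEG (✓`QTw_apply_eq_trueLinIter_sub_coarseGauge_T3`) writes
`QTw W A c` as `Q^{(K−n)}A ĉ` (∈ 𝔰𝔲(2): ✓`su_trueLinIter` under ✓`tower_loop_rows_of_regPr`) minus the coarse pure gauge of the linearised comb frames (∈ 𝔰𝔲(2):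
✓`combFrameResponse_mem_skewAdjoint_trace_zero`, conjugation by `W̄(ĉ) ∈ SU(2)`). The comb twin of ✓`QTwS_skewHermitian_traceless_of_regPr`.
[cite: Balaban1985BackgroundPropagators, (3.13)-(3.15) p.393; Balaban1985Variational, (44) p.285, (51) p.286] -/
theorem QTw_su_of_regPr {ε₀ : ℝ} (hε₀ : 0 < ε₀) (hε : 10 ^ 10 * (F.L : ℝ) ^ 6 * ε₀ ≤ 1)
    (W : GaugeField (F.P K) 0 (Matrix.specialUnitaryGroup (Fin 2) ℂ)) (hreg : RegPr F n K ε₀ W)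
    (A : PBond (F.P K) 0 → Matrix (Fin 2) (Fin 2) ℂ) (hA : ∀ b, star (A b) = -A b ∧ (A b).trace = 0) (c : PBond (F.P n) 0) :
    star (QTw F n K h W A c) = -QTw F n K h W A c ∧ (QTw F n K h W A c).trace = 0 := by
  obtain ⟨Q, hQ0, hQs⟩ := exists_trueLinIter_family (N := 2) W
  have hA' : ∀ b, A b ∈ skewAdjoint (Matrix (Fin 2) (Fin 2) ℂ) := fun b => skewAdjoint.mem_iff.2 (hA b).1
  have htr : ∀ b, (A b).trace = 0 := fun b => (hA b).2
  have hε7 := ten7_of_ten10 F hε₀ hε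
  rw [QTw_apply_eq_trueLinIter_sub_coarseGauge_T3 F h hε₀ hε W hreg Q hQ0 hQs A hA' htr c]
  obtain ⟨hα, -, haN⟩ := tower_loop_rows_of_regPr F hε₀ hε hreg
  have hQsu := su_trueLinIter W Q hQ0 hQs _ hα haN (Y := A) hA (K - n) le_rfl (bondShift (sites_eq F n K h) c)
  have hr : ∀ y : Site (F.P n) 0,
      star (fderiv ℂ (fun A : PBond (F.P K) 0 → Matrix (Fin 2) (Fin 2) ℂ => ((frameTw F n K h W A y : (Matrix (Fin 2) (Fin 2) ℂ)ˣ) : Matrix (Fin 2) (Fin 2) ℂ)) 0 A)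
          = -fderiv ℂ (fun A : PBond (F.P K) 0 → Matrix (Fin 2) (Fin 2) ℂ => ((frameTw F n K h W A y : (Matrix (Fin 2) (Fin 2) ℂ)ˣ) : Matrix (Fin 2) (Fin 2) ℂ)) 0 A ∧
        (fderiv ℂ (fun A : PBond (F.P K) 0 → Matrix (Fin 2) (Fin 2) ℂ => ((frameTw F n K h W A y : (Matrix (Fin 2) (Fin 2) ℂ)ˣ) : Matrix (Fin 2) (Fin 2) ℂ)) 0 A).trace = 0 :=
    fun y =>
    have h1 := combFrameResponse_mem_skewAdjoint_trace_zero F h hε₀ hε7 W hreg hA' htr y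
    ⟨skewAdjoint.mem_iff.1 h1.1, h1.2⟩
  exact su_sub hQsu (su_sub (hr c.src) (su_conj_coe _ (hr c.tgt)))

/-! ## §3 The Frobenius square of `QTw W A c` splits along the sectors -/

/-- ★★★ **THE COMB-CHART ROW SPLITS EXACTLY ALONG `𝔰𝔲(2) ⊕ i·𝔰𝔲(2) ⊕ ℂ·1`**: at `W ∈ 𝔘_k(ε₀)`, `10¹⁰L⁶ε₀ ≤ 1`, for `𝔰𝔲(2)`-valued `A₁, A₂`, a scalar field `τ` and every block bond `c`,
`‖frobEquiv⁻¹(QTw W (A₁ + I•A₂ + τ•1) c)‖² = ‖frobEquiv⁻¹(QTw W A₁ c)‖² + ‖frobEquiv⁻¹(QTw W A₂ c)‖² + ‖frobEquiv⁻¹(QTw W (τ•1) c)‖²` — ℂ-linearity of the CLM `QTw W`, §2, ✓p709300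
(`QTw W (τ•1) c ∈ ℂ•1`) and §1. [cite: Balaban1985BackgroundPropagators, (3.11) p.392, (3.13)-(3.15) p.393; Balaban1985Variational, (51) p.286] -/
theorem normSq_QTw_sectors_of_regPr {ε₀ : ℝ} (hε₀ : 0 < ε₀) (hε : 10 ^ 10 * (F.L : ℝ) ^ 6 * ε₀ ≤ 1)
    (W : GaugeField (F.P K) 0 (Matrix.specialUnitaryGroup (Fin 2) ℂ)) (hreg : RegPr F n K ε₀ W)
    (A₁ A₂ : PBond (F.P K) 0 → Matrix (Fin 2) (Fin 2) ℂ) (hA₁ : ∀ b, star (A₁ b) = -A₁ b ∧ (A₁ b).trace = 0) (hA₂ : ∀ b, star (A₂ b) = -A₂ b ∧ (A₂ b).trace = 0)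
    (τ : PBond (F.P K) 0 → ℂ) (c : PBond (F.P n) 0) :
    ‖(frobEquiv.symm (QTw F n K h W (fun b => A₁ b + Complex.I • A₂ b + τ b • (1 : Matrix (Fin 2) (Fin 2) ℂ)) c) : W₂)‖ ^ 2
      = ‖(frobEquiv.symm (QTw F n K h W A₁ c) : W₂)‖ ^ 2 + ‖(frobEquiv.symm (QTw F n K h W A₂ c) : W₂)‖ ^ 2
        + ‖(frobEquiv.symm (QTw F n K h W (fun b => τ b • (1 : Matrix (Fin 2) (Fin 2) ℂ)) c) : W₂)‖ ^ 2 := by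
  have hfun : (fun b => A₁ b + Complex.I • A₂ b + τ b • (1 : Matrix (Fin 2) (Fin 2) ℂ))
      = A₁ + Complex.I • A₂ + fun b => τ b • (1 : Matrix (Fin 2) (Fin 2) ℂ) := by
    funext b; simp only [Pi.add_apply, Pi.smul_apply]
  obtain ⟨s, hs⟩ := exists_QTw_smul_one_eq_smul_one_of_regPr F h hε₀ (ten7_of_ten10 F hε₀ hε) W hreg τ c
  rw [hfun, map_add, map_add, map_smul, Pi.add_apply, Pi.add_apply, Pi.smul_apply, hs]
  exact normSq_frob_sectors (QTw_su_of_regPr F h hε₀ hε W hreg A₁ hA₁ c) (QTw_su_of_regPr F h hε₀ hε W hreg A₂ hA₂ c) s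

/-- The same split summed over the block bonds (the `Σ_c ‖frobEquiv⁻¹(QTw W A c)‖²` currency of (QB) ∕ `‖Qkc W f‖²` of (QH1)). [cite: Balaban1985BackgroundPropagators, (3.11) p.392, (3.14) p.393] -/
theorem sum_normSq_QTw_sectors_of_regPr {ε₀ : ℝ} (hε₀ : 0 < ε₀) (hε : 10 ^ 10 * (F.L : ℝ) ^ 6 * ε₀ ≤ 1)
    (W : GaugeField (F.P K) 0 (Matrix.specialUnitaryGroup (Fin 2) ℂ)) (hreg : RegPr F n K ε₀ W)
    (A₁ A₂ : PBond (F.P K) 0 → Matrix (Fin 2) (Fin 2) ℂ) (hA₁ : ∀ b, star (A₁ b) = -A₁ b ∧ (A₁ b).trace = 0) (hA₂ : ∀ b, star (A₂ b) = -A₂ b ∧ (A₂ b).trace = 0)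
    (τ : PBond (F.P K) 0 → ℂ) :
    ∑ c : PBond (F.P n) 0, ‖(frobEquiv.symm (QTw F n K h W (fun b => A₁ b + Complex.I • A₂ b + τ b • (1 : Matrix (Fin 2) (Fin 2) ℂ)) c) : W₂)‖ ^ 2
      = ∑ c : PBond (F.P n) 0, ‖(frobEquiv.symm (QTw F n K h W A₁ c) : W₂)‖ ^ 2 + ∑ c : PBond (F.P n) 0, ‖(frobEquiv.symm (QTw F n K h W A₂ c) : W₂)‖ ^ 2
        + ∑ c : PBond (F.P n) 0, ‖(frobEquiv.symm (QTw F n K h W (fun b => τ b • (1 : Matrix (Fin 2) (Fin 2) ℂ)) c) : W₂)‖ ^ 2 := by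
  rw [← Finset.sum_add_distrib, ← Finset.sum_add_distrib]
  exact Finset.sum_congr rfl fun c _ => normSq_QTw_sectors_of_regPr F h hε₀ hε W hreg A₁ A₂ hA₁ hA₂ τ c

end Comb

/-! ## §4 The covariant curl and divergence at a unitary background preserve the sectors; their Frobenius squares split -/

section Stencils

variable {S : Type*} {ι : Type*} (T : ι → Equiv.Perm S) (U : ι → S → (Matrix (Fin 2) (Fin 2) ℂ)ˣ)

/-- Conjugation `R(V)X = VXV⁻¹` by a unitary unit preserves `𝔰𝔲(2)`. [cite: Balaban1985BackgroundPropagators, (3.5) p.391] -/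
theorem su_R {V : (Matrix (Fin 2) (Fin 2) ℂ)ˣ} (hV : star (V : Matrix (Fin 2) (Fin 2) ℂ) * (V : Matrix (Fin 2) (Fin 2) ℂ) = 1)
    {X : Matrix (Fin 2) (Fin 2) ℂ} (hX : star X = -X ∧ X.trace = 0) :
    star (R V X) = -R V X ∧ (R V X).trace = 0 := by
  have hinv : ((V⁻¹ : (Matrix (Fin 2) (Fin 2) ℂ)ˣ) : Matrix (Fin 2) (Fin 2) ℂ) = star (V : Matrix (Fin 2) (Fin 2) ℂ) :=
    Units.inv_eq_of_mul_eq_one_left hV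
  rw [R_def, hinv]
  exact su_conj hV hX

/-- The inverse of a unitary unit is unitary. [folklore] -/
theorem star_inv_mul_inv_of_unitary {V : (Matrix (Fin 2) (Fin 2) ℂ)ˣ} (hV : star (V : Matrix (Fin 2) (Fin 2) ℂ) * (V : Matrix (Fin 2) (Fin 2) ℂ) = 1) :
    star ((V⁻¹ : (Matrix (Fin 2) (Fin 2) ℂ)ˣ) : Matrix (Fin 2) (Fin 2) ℂ) * ((V⁻¹ : (Matrix (Fin 2) (Fin 2) ℂ)ˣ) : Matrix (Fin 2) (Fin 2) ℂ) = 1 := by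
  have hinv : ((V⁻¹ : (Matrix (Fin 2) (Fin 2) ℂ)ˣ) : Matrix (Fin 2) (Fin 2) ℂ) = star (V : Matrix (Fin 2) (Fin 2) ℂ) :=
    Units.inv_eq_of_mul_eq_one_left hV
  rw [hinv, star_star, ← hinv, Units.mul_inv]

variable (hU : ∀ (μ : ι) (x : S), star ((U μ x : (Matrix (Fin 2) (Fin 2) ℂ)ˣ) : Matrix (Fin 2) (Fin 2) ℂ) * ((U μ x : (Matrix (Fin 2) (Fin 2) ℂ)ˣ) : Matrix (Fin 2) (Fin 2) ℂ) = 1)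
include hU

/-- `D_{U,μ}` preserves `𝔰𝔲(2)`-valued site functions at a unitary background. [cite: Balaban1985BackgroundPropagators, (3.3) p.390] -/
theorem su_covD {f : S → Matrix (Fin 2) (Fin 2) ℂ} (hf : ∀ y, star (f y) = -f y ∧ (f y).trace = 0) (μ : ι) (x : S) :
    star (covD T U μ f x) = -covD T U μ f x ∧ (covD T U μ f x).trace = 0 := by
  rw [covD]
  exact su_sub (su_R (hU μ x) (hf _)) (hf x)

/-- `D*_{U,μ}` preserves `𝔰𝔲(2)`-valued site functions at a unitary background. [cite: Balaban1985BackgroundPropagators, (3.8) p.392] -/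
theorem su_covDstar {f : S → Matrix (Fin 2) (Fin 2) ℂ} (hf : ∀ y, star (f y) = -f y ∧ (f y).trace = 0) (μ : ι) (x : S) :
    star (covDstar T U μ f x) = -covDstar T U μ f x ∧ (covDstar T U μ f x).trace = 0 := by
  rw [covDstar]
  exact su_sub (su_R (star_inv_mul_inv_of_unitary (hU μ _)) (hf _)) (hf x)

/-- ★ **THE COVARIANT CURL OF AN `𝔰𝔲(2)`-VALUED ONE-FORM IS `𝔰𝔲(2)`-VALUED** at every unitary background. [cite: Balaban1985BackgroundPropagators, (3.4) p.391; Balaban1985Variational, (51) p.286] -/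
theorem su_curl {A : ι → S → Matrix (Fin 2) (Fin 2) ℂ} (hA : ∀ κ y, star (A κ y) = -A κ y ∧ (A κ y).trace = 0) (μ ν : ι) (x : S) :
    star (curl T U A μ ν x) = -curl T U A μ ν x ∧ (curl T U A μ ν x).trace = 0 := by
  rw [curl]
  exact su_sub (su_covD T U hU (hA ν) μ x) (su_covD T U hU (hA μ) ν x)

/-- ★ **THE COVARIANT DIVERGENCE OF AN `𝔰𝔲(2)`-VALUED ONE-FORM IS `𝔰𝔲(2)`-VALUED** at every unitary background. [cite: Balaban1985BackgroundPropagators, (3.8) p.392; Balaban1985Variational, (51) p.286] -/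
theorem su_divB [Fintype ι] {A : ι → S → Matrix (Fin 2) (Fin 2) ℂ} (hA : ∀ κ y, star (A κ y) = -A κ y ∧ (A κ y).trace = 0) (x : S) :
    star (divB T U A x) = -divB T U A x ∧ (divB T U A x).trace = 0 := by
  rw [divB]
  exact su_sum _ fun μ _ => su_covDstar T U hU (hA μ) μ x

omit hU in
/-- `divB` is additive in the one-form (pointwise form). [folklore] -/
theorem divB_add_apply [Fintype ι] (A B : ι → S → Matrix (Fin 2) (Fin 2) ℂ) (x : S) :
    divB T U (fun κ y => A κ y + B κ y) x = divB T U A x + divB T U B x := by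
  rw [divB, divB, divB, ← Finset.sum_add_distrib]
  exact Finset.sum_congr rfl fun μ _ => covDstar_add T U μ (A μ) (B μ) x

omit hU in
/-- `divB` is ℂ-homogeneous in the one-form (pointwise form). [folklore] -/
theorem divB_smul_apply [Fintype ι] (a : ℂ) (A : ι → S → Matrix (Fin 2) (Fin 2) ℂ) (x : S) :
    divB T U (fun κ y => a • A κ y) x = a • divB T U A x := by
  rw [divB, divB, Finset.smul_sum]
  exact Finset.sum_congr rfl fun μ _ => covDstar_smul T U a μ (A μ) x

/-- ★★ **THE FROBENIUS SQUARE OF THE COVARIANT CURL SPLITS ALONG THE SECTORS** (unitary background; per plaquette `p_{μν}(x)`).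
[cite: Balaban1985BackgroundPropagators, (3.4) p.391, (3.11) p.392; Balaban1985Variational, (51) p.286] -/
theorem normSq_curl_sectors (A₁ A₂ : ι → S → Matrix (Fin 2) (Fin 2) ℂ) (hA₁ : ∀ κ y, star (A₁ κ y) = -A₁ κ y ∧ (A₁ κ y).trace = 0)
    (hA₂ : ∀ κ y, star (A₂ κ y) = -A₂ κ y ∧ (A₂ κ y).trace = 0) (τ : ι → S → ℂ) (μ ν : ι) (x : S) :
    ‖(frobEquiv.symm (curl T U (fun κ y => A₁ κ y + Complex.I • A₂ κ y + τ κ y • (1 : Matrix (Fin 2) (Fin 2) ℂ)) μ ν x) : W₂)‖ ^ 2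
      = ‖(frobEquiv.symm (curl T U A₁ μ ν x) : W₂)‖ ^ 2 + ‖(frobEquiv.symm (curl T U A₂ μ ν x) : W₂)‖ ^ 2
        + ‖(frobEquiv.symm (curl T U (fun κ y => τ κ y • (1 : Matrix (Fin 2) (Fin 2) ℂ)) μ ν x) : W₂)‖ ^ 2 := by
  have hfun : (fun κ y => A₁ κ y + Complex.I • A₂ κ y + τ κ y • (1 : Matrix (Fin 2) (Fin 2) ℂ))
      = A₁ + Complex.I • A₂ + fun κ y => τ κ y • (1 : Matrix (Fin 2) (Fin 2) ℂ) := by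
    funext κ y; simp only [Pi.add_apply, Pi.smul_apply]
  rw [hfun, curl_add, curl_add, curl_smul, curl_smul_one T U τ μ ν x]
  exact normSq_frob_sectors (su_curl T U hU hA₁ μ ν x) (su_curl T U hU hA₂ μ ν x) _

/-- ★★ **THE FROBENIUS SQUARE OF THE COVARIANT DIVERGENCE SPLITS ALONG THE SECTORS** (unitary background; per site).
[cite: Balaban1985BackgroundPropagators, (3.8) p.392, (3.11) p.392; Balaban1985Variational, (51) p.286] -/
theorem normSq_divB_sectors [Fintype ι] (A₁ A₂ : ι → S → Matrix (Fin 2) (Fin 2) ℂ) (hA₁ : ∀ κ y, star (A₁ κ y) = -A₁ κ y ∧ (A₁ κ y).trace = 0)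
    (hA₂ : ∀ κ y, star (A₂ κ y) = -A₂ κ y ∧ (A₂ κ y).trace = 0) (τ : ι → S → ℂ) (x : S) :
    ‖(frobEquiv.symm (divB T U (fun κ y => A₁ κ y + Complex.I • A₂ κ y + τ κ y • (1 : Matrix (Fin 2) (Fin 2) ℂ)) x) : W₂)‖ ^ 2
      = ‖(frobEquiv.symm (divB T U A₁ x) : W₂)‖ ^ 2 + ‖(frobEquiv.symm (divB T U A₂ x) : W₂)‖ ^ 2
        + ‖(frobEquiv.symm (divB T U (fun κ y => τ κ y • (1 : Matrix (Fin 2) (Fin 2) ℂ)) x) : W₂)‖ ^ 2 := by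
  have h1 : divB T U (fun κ y => A₁ κ y + Complex.I • A₂ κ y + τ κ y • (1 : Matrix (Fin 2) (Fin 2) ℂ)) x
      = divB T U A₁ x + Complex.I • divB T U A₂ x + divB T U (fun κ y => τ κ y • (1 : Matrix (Fin 2) (Fin 2) ℂ)) x := by
    rw [divB_add_apply, divB_add_apply T U A₁, divB_smul_apply]
  rw [h1, divB_smul_one T U τ x]
  exact normSq_frob_sectors (su_divB T U hU hA₁ x) (su_divB T U hU hA₂ x) _

/-- ★★ the curl split in the ENTRYWISE currency `Σ_j Σ_k ‖(curl …) j k‖²` of ✓p706335's `CURL_HS`. [cite: Balaban1985BackgroundPropagators, (3.4) p.391, (3.11) p.392] -/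
theorem sum_normSq_curl_entries_sectors (A₁ A₂ : ι → S → Matrix (Fin 2) (Fin 2) ℂ) (hA₁ : ∀ κ y, star (A₁ κ y) = -A₁ κ y ∧ (A₁ κ y).trace = 0)
    (hA₂ : ∀ κ y, star (A₂ κ y) = -A₂ κ y ∧ (A₂ κ y).trace = 0) (τ : ι → S → ℂ) (μ ν : ι) (x : S) :
    ∑ j : Fin 2, ∑ k : Fin 2, ‖(curl T U (fun κ y => A₁ κ y + Complex.I • A₂ κ y + τ κ y • (1 : Matrix (Fin 2) (Fin 2) ℂ)) μ ν x) j k‖ ^ 2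
      = (∑ j : Fin 2, ∑ k : Fin 2, ‖(curl T U A₁ μ ν x) j k‖ ^ 2) + (∑ j : Fin 2, ∑ k : Fin 2, ‖(curl T U A₂ μ ν x) j k‖ ^ 2)
        + ∑ j : Fin 2, ∑ k : Fin 2, ‖(curl T U (fun κ y => τ κ y • (1 : Matrix (Fin 2) (Fin 2) ℂ)) μ ν x) j k‖ ^ 2 := by
  rw [← norm_sq_frobEquiv_symm, ← norm_sq_frobEquiv_symm, ← norm_sq_frobEquiv_symm, ← norm_sq_frobEquiv_symm]
  exact normSq_curl_sectors T U hU A₁ A₂ hA₁ hA₂ τ μ ν x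

/-- ★★ the divergence split in the ENTRYWISE currency `Σ_j Σ_k ‖(divB …) j k‖²` of ✓p706335's `DIV_HS`. [cite: Balaban1985BackgroundPropagators, (3.8) p.392, (3.11) p.392] -/
theorem sum_normSq_divB_entries_sectors [Fintype ι] (A₁ A₂ : ι → S → Matrix (Fin 2) (Fin 2) ℂ) (hA₁ : ∀ κ y, star (A₁ κ y) = -A₁ κ y ∧ (A₁ κ y).trace = 0)
    (hA₂ : ∀ κ y, star (A₂ κ y) = -A₂ κ y ∧ (A₂ κ y).trace = 0) (τ : ι → S → ℂ) (x : S) :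
    ∑ j : Fin 2, ∑ k : Fin 2, ‖(divB T U (fun κ y => A₁ κ y + Complex.I • A₂ κ y + τ κ y • (1 : Matrix (Fin 2) (Fin 2) ℂ)) x) j k‖ ^ 2
      = (∑ j : Fin 2, ∑ k : Fin 2, ‖(divB T U A₁ x) j k‖ ^ 2) + (∑ j : Fin 2, ∑ k : Fin 2, ‖(divB T U A₂ x) j k‖ ^ 2)
        + ∑ j : Fin 2, ∑ k : Fin 2, ‖(divB T U (fun κ y => τ κ y • (1 : Matrix (Fin 2) (Fin 2) ℂ)) x) j k‖ ^ 2 := by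
  rw [← norm_sq_frobEquiv_symm, ← norm_sq_frobEquiv_symm, ← norm_sq_frobEquiv_symm, ← norm_sq_frobEquiv_symm]
  exact normSq_divB_sectors T U hU A₁ A₂ hA₁ hA₂ τ x

end Stencils

/-! ## §5 Member instances: the background `unitsField (toUField W)` of an `SU(2)` field on the torus `torusT (F.P K) 0` -/

section Member

variable (F : T3Family) {K : ℕ}

/-- the route's background units are unitary: `↑(W b)ᴴ·↑(W b) = 1`. [cite: Balaban1985Averaging, (9) p.19, (19) p.21] -/
theorem star_unitsField_toUField_mul (W : GaugeField (F.P K) 0 (Matrix.specialUnitaryGroup (Fin 2) ℂ)) (κ : Fin (F.P K).d) (z : Site (F.P K) 0) :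
    star ((unitsField (toUField W) ⟨z, κ⟩ : (Matrix (Fin 2) (Fin 2) ℂ)ˣ) : Matrix (Fin 2) (Fin 2) ℂ)
        * ((unitsField (toUField W) ⟨z, κ⟩ : (Matrix (Fin 2) (Fin 2) ℂ)ˣ) : Matrix (Fin 2) (Fin 2) ℂ) = 1 := by
  rw [B10Eq27TorusAxialLog.val_unitsField]
  exact Matrix.mem_unitaryGroup_iff'.1 (toUField W ⟨z, κ⟩).2

/-- ★★ **`CURL_HS` SPLITS ALONG THE SECTORS AT THE MEMBER**, per plaquette, in ✓p706335's letters (`T := torusT (F.P K) 0`, `U := unitsField (toUField W)`).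
[cite: Balaban1985BackgroundPropagators, (3.4) p.391, (3.11) p.392; Balaban1985Variational, (51) p.286] -/
theorem sum_normSq_curl_entries_sectors_member (W : GaugeField (F.P K) 0 (Matrix.specialUnitaryGroup (Fin 2) ℂ))
    (A₁ A₂ : PBond (F.P K) 0 → Matrix (Fin 2) (Fin 2) ℂ) (hA₁ : ∀ b, star (A₁ b) = -A₁ b ∧ (A₁ b).trace = 0) (hA₂ : ∀ b, star (A₂ b) = -A₂ b ∧ (A₂ b).trace = 0)
    (τ : PBond (F.P K) 0 → ℂ) (μ ν : Fin (F.P K).d) (x : Site (F.P K) 0) :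
    ∑ j : Fin 2, ∑ k : Fin 2, ‖(curl (torusT (F.P K) 0) (fun κ z => unitsField (toUField W) ⟨z, κ⟩)
          (fun κ z => A₁ ⟨z, κ⟩ + Complex.I • A₂ ⟨z, κ⟩ + τ ⟨z, κ⟩ • (1 : Matrix (Fin 2) (Fin 2) ℂ)) μ ν x) j k‖ ^ 2
      = (∑ j : Fin 2, ∑ k : Fin 2, ‖(curl (torusT (F.P K) 0) (fun κ z => unitsField (toUField W) ⟨z, κ⟩) (fun κ z => A₁ ⟨z, κ⟩) μ ν x) j k‖ ^ 2)
        + (∑ j : Fin 2, ∑ k : Fin 2, ‖(curl (torusT (F.P K) 0) (fun κ z => unitsField (toUField W) ⟨z, κ⟩) (fun κ z => A₂ ⟨z, κ⟩) μ ν x) j k‖ ^ 2)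
        + ∑ j : Fin 2, ∑ k : Fin 2, ‖(curl (torusT (F.P K) 0) (fun κ z => unitsField (toUField W) ⟨z, κ⟩)
            (fun κ z => τ ⟨z, κ⟩ • (1 : Matrix (Fin 2) (Fin 2) ℂ)) μ ν x) j k‖ ^ 2 :=
  sum_normSq_curl_entries_sectors (torusT (F.P K) 0) (fun κ z => unitsField (toUField W) ⟨z, κ⟩) (fun κ z => star_unitsField_toUField_mul F W κ z)
    (fun κ z => A₁ ⟨z, κ⟩) (fun κ z => A₂ ⟨z, κ⟩) (fun _ _ => hA₁ _) (fun _ _ => hA₂ _) (fun κ z => τ ⟨z, κ⟩) μ ν x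

/-- ★★ **`DIV_HS` SPLITS ALONG THE SECTORS AT THE MEMBER**, per site, in ✓p706335's letters. [cite: Balaban1985BackgroundPropagators, (3.8) p.392, (3.11) p.392; Balaban1985Variational, (51) p.286] -/
theorem sum_normSq_divB_entries_sectors_member (W : GaugeField (F.P K) 0 (Matrix.specialUnitaryGroup (Fin 2) ℂ))
    (A₁ A₂ : PBond (F.P K) 0 → Matrix (Fin 2) (Fin 2) ℂ) (hA₁ : ∀ b, star (A₁ b) = -A₁ b ∧ (A₁ b).trace = 0) (hA₂ : ∀ b, star (A₂ b) = -A₂ b ∧ (A₂ b).trace = 0)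
    (τ : PBond (F.P K) 0 → ℂ) (x : Site (F.P K) 0) :
    ∑ j : Fin 2, ∑ k : Fin 2, ‖(divB (torusT (F.P K) 0) (fun κ z => unitsField (toUField W) ⟨z, κ⟩)
          (fun κ z => A₁ ⟨z, κ⟩ + Complex.I • A₂ ⟨z, κ⟩ + τ ⟨z, κ⟩ • (1 : Matrix (Fin 2) (Fin 2) ℂ)) x) j k‖ ^ 2
      = (∑ j : Fin 2, ∑ k : Fin 2, ‖(divB (torusT (F.P K) 0) (fun κ z => unitsField (toUField W) ⟨z, κ⟩) (fun κ z => A₁ ⟨z, κ⟩) x) j k‖ ^ 2)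
        + (∑ j : Fin 2, ∑ k : Fin 2, ‖(divB (torusT (F.P K) 0) (fun κ z => unitsField (toUField W) ⟨z, κ⟩) (fun κ z => A₂ ⟨z, κ⟩) x) j k‖ ^ 2)
        + ∑ j : Fin 2, ∑ k : Fin 2, ‖(divB (torusT (F.P K) 0) (fun κ z => unitsField (toUField W) ⟨z, κ⟩)
            (fun κ z => τ ⟨z, κ⟩ • (1 : Matrix (Fin 2) (Fin 2) ℂ)) x) j k‖ ^ 2 :=
  sum_normSq_divB_entries_sectors (torusT (F.P K) 0) (fun κ z => unitsField (toUField W) ⟨z, κ⟩) (fun κ z => star_unitsField_toUField_mul F W κ z)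
    (fun κ z => A₁ ⟨z, κ⟩) (fun κ z => A₂ ⟨z, κ⟩) (fun _ _ => hA₁ _) (fun _ _ => hA₂ _) (fun κ z => τ ⟨z, κ⟩) x

end Member

end Summit.QuantumFields.YangMills.Theorems.Prop7QTwSectors

end
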